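import Mathlib
import HarnessLib

/-!
# The polynomial Laplacian commutes with orthogonal linear substitutions

For a square matrix `A` over a commutative ring and the linear substitution `xᵢ ↦ Σⱼ A i j · xⱼ` of the variables of
`MvPolynomial σ R` (so that `(P ∘ A)(x) = P(A x)`), the chain rule gives `∂ⱼ(P ∘ A) = Σᵢ A i j · (∂ᵢP) ∘ A`, hence for `A Aᵀ = 1`
(orthogonal rows) `Δ(P ∘ A) = (ΔP) ∘ A` with `Δ = Σᵢ ∂ᵢ²`: harmonic polynomials stay harmonic under orthogonal changes of
variables, and homogeneity and degree are preserved [Axler–Bourdon–Ramey, *Harmonic Function Theory*, Ch. 1, p. 3: "if `T` is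
orthogonal and `u` is harmonic then `u ∘ T` is harmonic"].  Pure algebra (`MvPolynomial.bind₁`, `MvPolynomial.pderiv`); any finite
index type, any commutative ring.

Main results: `pderiv_bind₁` (chain rule for `bind₁`), `linSubst`, `eval_bind₁_linSubst`, `pderiv_bind₁_linSubst`,
`laplacian_bind₁_linSubst` (`A * Aᵀ = 1`), `isHomogeneous_bind₁_linSubst`.
-/

noncomputable section

open MvPolynomial
open scoped BigOperators

namespace Literature.Algebra.Polynomial

section ChainRule

variable {σ : Type*} [Fintype σ] [DecidableEq σ] {R : Type*} [CommRing R]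

/-- **Chain rule for polynomial substitution**: `∂ⱼ (bind₁ L P) = Σᵢ ∂ⱼ(L i) · bind₁ L (∂ᵢ P)`.
[cite: AxlerBourdonRamey2001, Ch. 1 (p. 3)] -/
theorem pderiv_bind₁ (L : σ → MvPolynomial σ R) (j : σ) (P : MvPolynomial σ R) :
    pderiv j (bind₁ L P) = ∑ i, pderiv j (L i) * bind₁ L (pderiv i P) := by
  induction P using MvPolynomial.induction_on with
  | C a => simp
  | add p q hp hq =>
    simp only [map_add, hp, hq, mul_add, Finset.sum_add_distrib]
  | mul_X p k hp =>
    have hs : ∀ i, bind₁ L (pderiv i (X k : MvPolynomial σ R)) = if i = k then 1 else 0 := by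
      intro i
      rw [pderiv_X]
      by_cases h : i = k
      · subst h; simp
      · simp [h]
    simp_rw [map_mul, bind₁_X_right, pderiv_mul, map_add, map_mul, bind₁_X_right, hs, hp, mul_add,
      Finset.sum_add_distrib, mul_ite, mul_one, mul_zero, Finset.sum_ite_eq', Finset.mem_univ, if_true,
      Finset.sum_mul]
    congr 1
    · exact Finset.sum_congr rfl fun i _ => by ring
    · ring

end ChainRule

section Linear

variable {σ : Type*} [Fintype σ] [DecidableEq σ] {R : Type*} [CommRing R]

/-- The linear substitution `xᵢ ↦ Σⱼ A i j · xⱼ` attached to a square matrix `A`. [cite: AxlerBourdonRamey2001, Ch. 1 (p. 3)] -/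
def linSubst (A : Matrix σ σ R) : σ → MvPolynomial σ R := fun i => ∑ j, C (A i j) * X j

omit [DecidableEq σ] in
/-- Evaluation: `(bind₁ (linSubst A) P)(x) = P(A x)`. [cite: AxlerBourdonRamey2001, Ch. 1 (p. 3)] -/
theorem eval_bind₁_linSubst (A : Matrix σ σ R) (x : σ → R) (P : MvPolynomial σ R) :
    eval x (bind₁ (linSubst A) P) = eval (A.mulVec x) P := by
  rw [show eval x (bind₁ (linSubst A) P) = eval (fun i => eval x (linSubst A i)) P from eval₂Hom_bind₁ _ _ _ _]
  have hfun : (fun i => eval x (linSubst A i)) = A.mulVec x := by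
    funext i
    simp [linSubst, Matrix.mulVec, dotProduct, map_sum]
  rw [hfun]

/-- `∂ⱼ (Σₖ A i k xₖ) = A i j`. [cite: AxlerBourdonRamey2001, Ch. 1 (p. 3)] -/
theorem pderiv_linSubst (A : Matrix σ σ R) (j i : σ) : pderiv j (linSubst A i) = C (A i j) := by
  simp only [linSubst, map_sum, pderiv_C_mul, pderiv_X]
  rw [Finset.sum_eq_single j]
  · simp
  · intro k _ hk; simp [hk]
  · intro h; exact absurd (Finset.mem_univ j) h

/-- **Chain rule for a linear substitution**: `∂ⱼ (P ∘ A) = Σᵢ A i j · (∂ᵢ P) ∘ A`. [cite: AxlerBourdonRamey2001, Ch. 1 (p. 3)] -/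
theorem pderiv_bind₁_linSubst (A : Matrix σ σ R) (j : σ) (P : MvPolynomial σ R) :
    pderiv j (bind₁ (linSubst A) P) = ∑ i, C (A i j) * bind₁ (linSubst A) (pderiv i P) := by
  rw [pderiv_bind₁]
  simp only [pderiv_linSubst]

/-- **The Laplacian commutes with orthogonal substitutions**: if `A Aᵀ = 1` then
`Σⱼ ∂ⱼ² (P ∘ A) = (Σᵢ ∂ᵢ² P) ∘ A`. [cite: AxlerBourdonRamey2001, Ch. 1 (p. 3)] -/
theorem laplacian_bind₁_linSubst (A : Matrix σ σ R) (hA : A * A.transpose = 1) (P : MvPolynomial σ R) :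
    ∑ j, pderiv j (pderiv j (bind₁ (linSubst A) P)) = bind₁ (linSubst A) (∑ i, pderiv i (pderiv i P)) := by
  -- expand both derivatives by the chain rule
  have h1 : ∀ j, pderiv j (pderiv j (bind₁ (linSubst A) P)) =
      ∑ i, ∑ i', C (A i j * A i' j) * bind₁ (linSubst A) (pderiv i' (pderiv i P)) := by
    intro j
    rw [pderiv_bind₁_linSubst, map_sum]
    refine Finset.sum_congr rfl fun i _ => ?_
    rw [pderiv_C_mul, pderiv_bind₁_linSubst, Finset.mul_sum]
    refine Finset.sum_congr rfl fun i' _ => ?_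
    rw [map_mul]; ring
  simp_rw [h1]
  rw [Finset.sum_comm]
  -- `Σⱼ A i j A i' j = (A Aᵀ) i i' = δ_{i i'}`
  have hAA : ∀ i i', ∑ j, A i j * A i' j = if i = i' then 1 else 0 := by
    intro i i'
    have := congrFun (congrFun hA i) i'
    simpa [Matrix.mul_apply, Matrix.transpose_apply, Matrix.one_apply] using this
  have h2 : ∀ i, ∑ j, ∑ i', C (A i j * A i' j) * bind₁ (linSubst A) (pderiv i' (pderiv i P)) =
      bind₁ (linSubst A) (pderiv i (pderiv i P)) := by
    intro i
    rw [Finset.sum_comm]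
    have h3 : ∀ i', ∑ j, C (A i j * A i' j) * bind₁ (linSubst A) (pderiv i' (pderiv i P)) =
        C (∑ j, A i j * A i' j) * bind₁ (linSubst A) (pderiv i' (pderiv i P)) := by
      intro i'
      rw [← Finset.sum_mul, map_sum]
    simp_rw [h3, hAA]
    simp [apply_ite C, ite_mul, Finset.sum_ite_eq]
  simp_rw [h2]
  rw [map_sum]

/-- Harmonic polynomials stay harmonic under orthogonal substitutions. [cite: AxlerBourdonRamey2001, Ch. 1 (p. 3)] -/
theorem laplacian_bind₁_linSubst_eq_zero (A : Matrix σ σ R) (hA : A * A.transpose = 1) {P : MvPolynomial σ R}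
    (hP : ∑ i, pderiv i (pderiv i P) = 0) : ∑ j, pderiv j (pderiv j (bind₁ (linSubst A) P)) = 0 := by
  rw [laplacian_bind₁_linSubst A hA, hP, map_zero]

end Linear

section Homogeneous

variable {σ : Type*} [Fintype σ] {R : Type*} [CommRing R]

/-- The rows of `A` are linear forms: `linSubst A i` is homogeneous of degree `1`. [cite: AxlerBourdonRamey2001, Ch. 1 (p. 3)] -/
theorem isHomogeneous_linSubst (A : Matrix σ σ R) (i : σ) : (linSubst A i).IsHomogeneous 1 :=
  IsHomogeneous.sum _ _ _ fun j _ => (isHomogeneous_X R j).C_mul (A i j)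

/-- A linear substitution preserves homogeneity and degree. [cite: AxlerBourdonRamey2001, Ch. 1 (p. 3)] -/
theorem isHomogeneous_bind₁_linSubst (A : Matrix σ σ R) {P : MvPolynomial σ R} {n : ℕ} (hP : P.IsHomogeneous n) :
    (bind₁ (linSubst A) P).IsHomogeneous n := by
  have h := hP.eval₂ (C : R →+* MvPolynomial σ R) (linSubst A) (fun r => isHomogeneous_C σ r)
    (fun i => isHomogeneous_linSubst A i)
  rw [one_mul] at h
  rw [← aeval_eq_bind₁, aeval_def, algebraMap_eq]
  exact h

end Homogeneous

end Literature.Algebra.Polynomial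

end
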